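import Summits.Ventures.Crystal3D.Theorems.StickyWulffConstantTextureBuildFill
import Summits.Ventures.Crystal3D.Theorems.StickyWulffConstantTextureLiminfBarlowSampleBonds
import Summits.Ventures.Crystal3D.Theorems.StickyWulffConstantTextureBuildBarlowShells
import HarnessLib

/-!
# TB-1 brick L-HEAL: replacing the material of a region by the grain's lattice never raises the deficiency (solid clean collar)
# (lane T, crux `TextureLiminfV5`, stmt-Ventures-23912; census memo HOME/wulff-p2/g23/TB-COVER-CENSUS-g23.md §F2 — the healed cover `CoverH`, '…TextureBuildHealedComposition')

HONEST FRAMING. Venture `Summits/Ventures/Crystal3D` (cell `crystal3d-full`), route `route-Ventures-StickyWulffConstant`, helper `--supports` the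
law-v5 crux `TextureLiminfV5` (stmt-Ventures-23912).  Pure finite combinatorics (census-free, standard axioms); the sequel of L-fill ('…TextureBuildFill':
ADDING fully coordinated balls never raises `D`).  Nothing about any cover or texture is claimed; F-C1 not moved.

WHY.  The healed binder `CoverH` (p744930) lets the TB-cover be built on a configuration `x'` obtained from the cluster by HEALING — removing sparse bounded
junk (e.g. the saturated, unfillable «C-flip» defects of the census memo §F1, which block lattice sites and so spoil the complete plates of every wall cell)
and refilling the grain's lattice sites — provided `6N' − b(x') ≤ 6N − b(x)`.  This file is that inequality:

* `twelve_le_cdeg_of_touching_subset` — a site of a moved Barlow stacking all of whose twelve touching sites lie in `Y` has `cdeg Y ≥ 12`;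
* **`contactDeficiency_heal_le_of_degrees`** — ABSTRACT HEAL: for a packing `X`, a region `B` and new balls `V ⊆ B`, the healed configuration
  `X' := {a ∈ X | a ∉ B} ∪ V` has `D(X') ≤ D(X)` as soon as every new ball is fully coordinated in `X'` and no kept ball loses degree
  (`D = ½Σ(12 − cdeg)`: new balls contribute `0`, kept balls no more than before, removed balls contributed `≥ 0`);
* **`contactDeficiency_heal_le`** — GEOMETRIC HEAL: `S` a moved Barlow stacking, `V` = ALL `S`-sites in `B`; if the COLLAR is clean and solid — every kept
  ball within `1` of a ball or site in `B` lies on `S` (`hcolS`), and every `S`-site outside `B` touching a kept ball that touches `B`, or touching a site of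
  `V`, is a ball (`hcolX`, `hcolV`) — then `X'` is a packing (`heal_sep`), `D(X') ≤ D(X)`, and `#X ≤ #X' + #(X ∩ B)` (`card_le_card_heal_add`).
Isolated bounded defects inside an otherwise perfect grain are healed by taking for `B` a ball around the defect.
-/

noncomputable section

namespace Summit.Ventures.Crystal3D.Theorems

open Finset Summit.Ventures.Crystal3D
open Literature.MathematicalPhysics.StatisticalMechanics (IsHaggSeq contactDeficiency)
open Summit.Ventures.Crystal3D.Cruxes.TextureLiminf.TexShadow (E3 stacking)

/-! ## Twelve touching sites in `Y` give degree twelve -/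

/-- A site of a moved Barlow stacking all of whose (twelve) touching sites lie in `Y` has `cdeg Y ≥ 12`. -/
theorem twelve_le_cdeg_of_touching_subset {L : E3 ≃ₗᵢ[ℝ] E3} {s : E3} {σ : ℤ → ℤ} (hσ : IsHaggSeq σ) {a : E3}
    (ha : a ∈ stacking L s σ) {Y : Finset E3} (hY : ∀ w ∈ stacking L s σ, dist a w = 1 → w ∈ Y) : 12 ≤ cdeg Y a := by
  classical
  have hT := ncard_touching_stacking_eq_twelve hσ ha
  have hsub : {y | y ∈ stacking L s σ ∧ dist a y = 1} ⊆ ↑(Y.filter fun q => dist a q = 1) := by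
    intro y hy
    rw [Finset.coe_filter]
    exact ⟨hY y hy.1 hy.2, hy.2⟩
  have h := Set.ncard_le_ncard hsub (Finset.finite_toSet _)
  rw [hT, Set.ncard_coe_finset] at h
  exact h

/-! ## Abstract heal -/

section Abstract

variable (X V : Finset E3) (B : Set E3) [DecidablePred (· ∈ B)]

/-- the HEALED configuration: the balls of `X` outside `B`, and the new balls `V`. -/
def heal : Finset E3 := X.filter (fun a => a ∉ B) ∪ V

/-- Membership in the healed configuration. -/
theorem mem_heal {a : E3} : a ∈ heal X V B ↔ (a ∈ X ∧ a ∉ B) ∨ a ∈ V := by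
  unfold heal; rw [Finset.mem_union, Finset.mem_filter]

variable {X V B}

/-- **ABSTRACT HEAL**: `D(heal) ≤ D(X)` when `X` is a packing, the new balls lie in `B` and are fully coordinated in the healed configuration, and no kept
ball has smaller degree in the healed configuration than in `X`. -/
theorem contactDeficiency_heal_le_of_degrees (hX : ∀ p ∈ X, ∀ q ∈ X, p ≠ q → 1 ≤ dist p q) (hVB : ∀ v ∈ V, v ∈ B)
    (hfull : ∀ v ∈ V, 12 ≤ cdeg (heal X V B) v) (hkept : ∀ a ∈ X, a ∉ B → cdeg X a ≤ cdeg (heal X V B) a) :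
    contactDeficiency (heal X V B) ≤ contactDeficiency X := by
  classical
  set Y := heal X V B with hYdef
  set K := X.filter (fun a => a ∉ B) with hKdef
  have hKV : Disjoint K V := by
    rw [Finset.disjoint_left]
    intro a haK haV
    rw [hKdef, Finset.mem_filter] at haK
    exact haK.2 (hVB a haV)
  have hYKV : Y = K ∪ V := rfl
  rw [contactDeficiency_eq_sum_halfDefect, contactDeficiency_eq_sum_halfDefect, hYKV, Finset.sum_union hKV]
  -- new balls contribute nothing
  have hV0 : ∑ v ∈ V, halfDefect (K ∪ V) v ≤ 0 := by
    refine Finset.sum_nonpos fun v hv => ?_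
    have h : 12 ≤ cdeg (K ∪ V) v := hfull v hv
    have h' : (12 : ℝ) ≤ (cdeg (K ∪ V) v : ℝ) := by exact_mod_cast h
    unfold halfDefect; linarith
  -- kept balls contribute no more than before
  have hK : ∑ a ∈ K, halfDefect (K ∪ V) a ≤ ∑ a ∈ K, halfDefect X a := by
    refine Finset.sum_le_sum fun a ha => ?_
    rw [hKdef, Finset.mem_filter] at ha
    have h : cdeg X a ≤ cdeg (K ∪ V) a := hkept a ha.1 ha.2
    have h' : (cdeg X a : ℝ) ≤ (cdeg (K ∪ V) a : ℝ) := by exact_mod_cast h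
    unfold halfDefect; linarith
  -- removed balls contributed nonnegative amounts
  have hKX : K ⊆ X := Finset.filter_subset _ _
  have hdrop : ∑ a ∈ K, halfDefect X a ≤ ∑ a ∈ X, halfDefect X a :=
    Finset.sum_le_sum_of_subset_of_nonneg hKX fun a _ _ => halfDefect_nonneg X hX a
  linarith

end Abstract

/-! ## Geometric heal: refill the grain's lattice in a region with a clean solid collar -/

section Geometric

variable {L : E3 ≃ₗᵢ[ℝ] E3} {s : E3} {σ : ℤ → ℤ} {X V : Finset E3} {B : Set E3} [DecidablePred (· ∈ B)]

/-- **GEOMETRIC HEAL, packing**: if every kept ball within distance `< 1` of a new site lies on the stacking, the healed configuration is a packing. -/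
theorem heal_sep (hσ : IsHaggSeq σ) (hX : ∀ p ∈ X, ∀ q ∈ X, p ≠ q → 1 ≤ dist p q)
    (hVS : ∀ v ∈ V, v ∈ stacking L s σ)
    (hcolS : ∀ a ∈ X, a ∉ B → ∀ v ∈ V, dist a v < 1 → a ∈ stacking L s σ) :
    ∀ p ∈ heal X V B, ∀ q ∈ heal X V B, p ≠ q → 1 ≤ dist p q := by
  have hSS : ∀ p ∈ stacking L s σ, ∀ q ∈ stacking L s σ, p ≠ q → 1 ≤ dist p q := fun p hp q hq hpq =>
    Summit.Ventures.Crystal3D.Cruxes.TextureLiminf.TexShadow.one_le_dist_of_mem_stacking hσ hp hq hpq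
  intro p hp q hq hpq
  rw [mem_heal] at hp hq
  rcases hp with ⟨hpX, hpB⟩ | hpV <;> rcases hq with ⟨hqX, hqB⟩ | hqV
  · exact hX p hpX q hqX hpq
  · by_contra hlt
    push Not at hlt
    exact absurd (hSS p (hcolS p hpX hpB q hqV hlt) q (hVS q hqV) hpq) (not_le.2 hlt)
  · by_contra hlt
    push Not at hlt
    have hlt' : dist q p < 1 := by rw [dist_comm]; exact hlt
    have := hSS q (hcolS q hqX hqB p hpV hlt') p (hVS p hpV) (Ne.symm hpq)
    rw [dist_comm] at this
    exact absurd this (not_le.2 hlt)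
  · exact hSS p (hVS p hpV) q (hVS q hqV) hpq

/-- **GEOMETRIC HEAL, deficiency**: `S` a moved Barlow stacking, `X` a packing, `B` a region, `V` the set of ALL `S`-sites in `B`.  If the collar is CLEAN
(every kept ball within `1` of a ball of `X` in `B` or of a site of `V` lies on `S`) and SOLID (every `S`-site outside `B` touching such a kept ball, or
touching a site of `V`, is a ball of `X`), then `D(heal X V B) ≤ D(X)`. -/
theorem contactDeficiency_heal_le (hσ : IsHaggSeq σ) (hX : ∀ p ∈ X, ∀ q ∈ X, p ≠ q → 1 ≤ dist p q)
    (hVS : ∀ v ∈ V, v ∈ stacking L s σ) (hVB : ∀ v ∈ V, v ∈ B) (hVall : ∀ w ∈ stacking L s σ, w ∈ B → w ∈ V)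
    (hcolS : ∀ a ∈ X, a ∉ B → (∃ y, (y ∈ X ∨ y ∈ V) ∧ y ∈ B ∧ dist a y ≤ 1) → a ∈ stacking L s σ)
    (hcolX : ∀ a ∈ X, a ∉ B → (∃ y, (y ∈ X ∨ y ∈ V) ∧ y ∈ B ∧ dist a y ≤ 1) →
      ∀ w ∈ stacking L s σ, dist a w = 1 → w ∉ B → w ∈ X)
    (hcolV : ∀ v ∈ V, ∀ w ∈ stacking L s σ, dist v w = 1 → w ∉ B → w ∈ X) :
    contactDeficiency (heal X V B) ≤ contactDeficiency X := by
  classical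
  refine contactDeficiency_heal_le_of_degrees hX hVB ?_ ?_
  · -- new sites are fully coordinated: their touching sites are in `V` (inside `B`) or kept balls (outside `B`)
    intro v hv
    refine twelve_le_cdeg_of_touching_subset hσ (hVS v hv) fun w hw hdw => ?_
    rw [mem_heal]
    by_cases hwB : w ∈ B
    · exact Or.inr (hVall w hw hwB)
    · exact Or.inl ⟨hcolV v hv w hw hdw hwB, hwB⟩
  · -- kept balls do not lose degree
    intro a haX haB
    by_cases htouch : ∃ y, (y ∈ X ∨ y ∈ V) ∧ y ∈ B ∧ dist a y ≤ 1
    · -- `a` touches `B`: it is a site, and all twelve of its touching sites are in the healed configuration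
      have haS := hcolS a haX haB htouch
      have h12 : 12 ≤ cdeg (heal X V B) a := by
        refine twelve_le_cdeg_of_touching_subset hσ haS fun w hw hdw => ?_
        rw [mem_heal]
        by_cases hwB : w ∈ B
        · exact Or.inr (hVall w hw hwB)
        · exact Or.inl ⟨hcolX a haX haB htouch w hw hdw hwB, hwB⟩
      exact (cdeg_le_twelve X hX a).trans h12
    · -- `a` touches nothing in `B`: its contacts in `X` are kept balls
      push Not at htouch
      unfold cdeg
      refine Finset.card_le_card fun q hq => ?_
      rw [Finset.mem_filter] at hq ⊢
      refine ⟨(mem_heal X V B).2 (Or.inl ⟨hq.1, fun hqB => ?_⟩), hq.2⟩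
      have := htouch q (Or.inl hq.1) hqB
      linarith [hq.2]

/-- The healed configuration loses at most the balls of `X` in `B`: `#X ≤ #(heal) + #{a ∈ X | a ∈ B}`. -/
theorem card_le_card_heal_add (X V : Finset E3) (B : Set E3) [DecidablePred (· ∈ B)] :
    X.card ≤ (heal X V B).card + (X.filter fun a => a ∈ B).card := by
  classical
  have h1 : (X.filter fun a => a ∉ B).card ≤ (heal X V B).card := Finset.card_le_card Finset.subset_union_left
  have h2 : (X.filter fun a => a ∉ B).card + (X.filter fun a => a ∈ B).card = X.card := by
    rw [add_comm]; exact Finset.card_filter_add_card_filter_not (fun a => a ∈ B)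
  omega

end Geometric

end Summit.Ventures.Crystal3D.Theorems

end
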